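import Summits.Ventures.CertifiedManyBodySolver.Rows.CorrWindowCertKernelChainQuotAdjNearCloser
import Summits.Ventures.CertifiedManyBodySolver.Rows.CARPolyWindowGramContractPairs
import Summits.Ventures.CertifiedManyBodySolver.Rows.CorrWindowBoxHamiltonian
import Summits.Ventures.CertifiedManyBodySolver.Rows.CorrWindowCertDictionaryEnergy
import HarnessLib

/-!
# STEP-0 AT BOX GEOMETRY — the exporter's literal template: the `↓` bond row at `(1, −3/10, 29/5)` (read at `n₀ = 1`: value `−1`,
# slope `−1`) on the ARITHMETIC window tables (`BoxGeom`: outer box `R = 1`, inner box `r = 0`, shifts `‖v‖∞ ≤ 1`), the kernel-cheap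
# Hamiltonian `hamTermsBox`, contracted Gram (word + partner tables), eom-near slices, `stepEQA`, closer `…GNear` — ZERO hypotheses and
# NOT ONE enumerated table fact

HONEST FRAMING: a TOY; its point is that every geometry hypothesis of the closer of record is discharged BY NAME from
`Rows/CorrWindowBoxGeometry.lean` / `Rows/CorrWindowBoxHamiltonian.lean` (`boxXs_mem`, `boxXs_boxIx`, `boxXs_injective`, `boxXs_cover`,
`boxD_orb`, `boxD_injective`, `boxD_spin`, `boxD_boxPush`, `box_hokV`, `boxW_mono`, `thicken_boxW_subset`, `thicken_zero_one_eq`,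
`zero_mem_boxW`, `termOp_hamTermsBox`, `termOp_energyTermsIdx` with `boxIx`) — exactly what an `N = 625` instance does with `R = 12`,
`r = 6`, `vmax = 6`. Letters: outer index `4` = the origin, `7` = `e₁` (`boxXs 1 i = (i / 3 − 1, i % 3 − 1)`); inner index `0` = the
origin. The validator licenses the identity code only (`S = {1}`); real instances use all eight codes with `S = univ`. Trust base: the
Lean kernel (std axioms). No number of record; no existing claim node discharged; CONTROL/CALIBRATION context (wording (xx1)); silent
on ρ_s = 0 / presence / T_c / phase; nothing about La₂CuO₄; no summit statement is proved by this file. Seat hubbard-obs-p2 (STIFFNESS),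
`prover-hubbard-obs-p2-g23-0`, zero compute.

References: X. Han, arXiv:2006.06002 §3 [Han2020Bootstrap]; J. Wang et al., PRX 14 (2024) 031006 §III [WangEtAl2024];
C. Jansson, D. Chaykin, C. Keil, SIAM J. Numer. Anal. 46 (2008) 180 [JanssonChaykinKeil2008].
-/

namespace Summit.Ventures.CertifiedManyBodySolver

namespace CARPolyWindow

namespace ToyBox1

open Summit.Ventures.CertifiedQuantumChemistry Summit.Ventures.CertifiedQuantumChemistry.CARPoly
open Literature.MathematicalPhysics.QuantumLattice Literature.MathematicalPhysics.QuantumLattice.HubbardWave0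
open Literature.MathematicalPhysics.QuantumManyBody.StateRelaxation
open Literature.Probability.LatticeModels ThermodynamicLimit Filter Topology
open Matrix BoxGeom
open scoped ComplexOrder BigOperators

/-! ## Data (outer box `R = 1`: 9 sites, index 4 = origin, 7 = e₁; inner box `r = 0`: 1 site) -/

/-- The objective: the `↓`-spin bond word through the origin and `e₁`. [folklore] -/
def TXb : Terms (Orb (Fin 9)) := [([(orb 4 1, true), (orb 7 1, false)], 1), ([(orb 7 1, true), (orb 4 1, false)], 1)]

/-- Density multipliers `μ_↑ = 0`, `μ_↓ = −2`. [folklore] -/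
def mub (σ : Fin 2) : ℚ := if σ = 1 then -2 else 0

/-- The word table: `v = a_{0↓} + a_{e₁↓}` in one copy, row `[1]`, `K = 0`. [cite: Han2020Bootstrap, §2 eq. (2)] -/
def wordsb : WordTable (Orb (Fin 9)) := [([([(orb 4 1, false)], 1), ([(orb 7 1, false)], 1)], [(0, [1])])]

/-- The partner table. [folklore] -/
def Qb : List (ℕ × List ℕ) := [(0, [0])]

/-- The three contraction facts, decided by the kernel. [folklore] -/
theorem wordsb_checks : (rangeB wordsb 1 Qb && sortedB wordsb.length 1 (pairsOf wordsb Qb) && countB wordsb 1 (pairsOf wordsb Qb)) = true := by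
  decide

/-- The tables: `boxQuot 0 1 1` with the validator restricted to the identity code (so that `S = {1}`). [folklore] -/
def Db : QuotData 9 1 where
  xs := boxXs 1
  ix := boxIx 1
  xsβ := boxXs 0
  f := boxPush 0 1
  ok := fun γc v => decide (γc = 0) && boxOk 1 γc v

/-- The kernel-cheap window Hamiltonian of the 3 × 3 box. [cite: XuEtAl2024, eq. (1)] -/
def THb : Terms (Orb (Fin 9)) := hamTermsBox 1 1 (-3 / 10) (29 / 5)

/-- The mean-energy dictionary read through `boxIx`. [folklore] -/
def TEb : Terms (Orb (Fin 9)) := energyTermsIdx 1 (-3 / 10) (29 / 5) (boxIx 1)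

/-- The eom-near residual slices (no eom generators), contracted Gram, regrouped `[1, 1 | rest]` into 3 chain slices.
[cite: WangEtAl2024, §III] -/
def slicesb : List (Terms (Orb (Fin 9))) :=
  groupSlices (residTGslicesNear TXb mub 0 (fun σ => orb 4 σ) 0 0 0 0 TEb (gramContractSlices 0 wordsb (pairsOf wordsb Qb)) THb Db.f [] []
    (fun l : Fin 0 => l.elim0) (fun l : Fin 0 => l.elim0) [] []) [1, 1]

/-- The hint lists: «`n_{e₁↓}` is `n_{0↓}` moved by `(γ = 1, v = e₁)`» on the Gram slice. [cite: Han2020Bootstrap, §3] -/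
def hintsb : List (List (QHint 1)) := [[], [⟨0, (1, 0), ([orb 0 1], [orb 0 1])⟩], []]

/-! ## Accumulators and per-step KERNEL facts -/

/-- Accumulator after step 1: `eval%` literal. [folklore] -/
def Cb1 : SOSDual.EncPoly := eval% stepEQA Db 32 ([] : SOSDual.EncPoly) (slicesb.getD 0 []) (hintsb.getD 0 [])
/-- Accumulator after step 2. [folklore] -/
def Cb2 : SOSDual.EncPoly := eval% stepEQA Db 32 Cb1 (slicesb.getD 1 []) (hintsb.getD 1 [])
/-- Accumulator after step 3. [folklore] -/
def Cb3 : SOSDual.EncPoly := eval% stepEQA Db 32 Cb2 (slicesb.getD 2 []) (hintsb.getD 2 [])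
/-- The accumulator list. [folklore] -/
def Cbs : List SOSDual.EncPoly := [[], Cb1, Cb2, Cb3]

/-- KERNEL FACT, step 1 of 3. [folklore] -/
theorem box_step_0 : Cbs.getD (0 + 1) [] = stepEQA Db 32 (Cbs.getD 0 []) (slicesb.getD 0 []) (hintsb.getD 0 []) :=
  eq_of_beq (by decide +kernel)
/-- KERNEL FACT, step 2 of 3 (hint checked through `boxIx`/`boxXs` arithmetic and accepted). [folklore] -/
theorem box_step_1 : Cbs.getD (1 + 1) [] = stepEQA Db 32 (Cbs.getD 1 []) (slicesb.getD 1 []) (hintsb.getD 1 []) :=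
  eq_of_beq (by decide +kernel)
/-- KERNEL FACT, step 3 of 3. [folklore] -/
theorem box_step_2 : Cbs.getD (2 + 1) [] = stepEQA Db 32 (Cbs.getD 2 []) (slicesb.getD 2 []) (hintsb.getD 2 []) :=
  eq_of_beq (by decide +kernel)

/-- The chain record by `Fin 3` pattern match. [cite: JanssonChaykinKeil2008, §3] -/
theorem box_chain_ok : ChainQAOK Db 32 3 Cbs slicesb hintsb where
  len := by decide +kernel
  step i := match i with
    | ⟨0, _⟩ => box_step_0
    | ⟨1, _⟩ => box_step_1
    | ⟨2, _⟩ => box_step_2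
    | ⟨n + 3, h⟩ => absurd h (by omega)

/-- Everything cancels: the last accumulator is EMPTY. [folklore] -/
theorem box_last_nil : Cbs.getD 3 [] = [] := by decide +kernel

/-- The ONE rational inequality, read at `n₀ = 1`. [cite: WangEtAl2024, §III] -/
theorem box_lowerConst : (-1 : ℚ) ≤ lowerConst (SOSDual.decPoly 9 (Cbs.getD 3 [])) + (mub 0 + mub 1) * ((1 : ℚ) / 2 - 0) := by
  decide +kernel

/-! ## The end-to-end theorem, every geometry fact by name -/

/-- Membership-proof irrelevance for ordered sites. [folklore] -/
private theorem pt_congr_b {Λ : Finset (Site 2)} {x y : Site 2} (hx : x ∈ Λ) (hy : y ∈ Λ) (h : x = y) :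
    PolySite.pt x hx = PolySite.pt y hy := by
  subst h; rfl

/-- **STEP-0 at box geometry: the affine-N claim-node predicate for the `↓` bond word on `boxW 1`, read at `n₀ = 1` (value `−1`, slope
`−1`), orbit set `{1}` — ZERO hypotheses, all table facts by name.** [cite: WangEtAl2024, §III] [cite: Han2020Bootstrap, §3] -/
theorem box_affineOrbitLowerRowN :
    SquareTTPrimeCorrAffineOrbitLowerRowN (((-3 / 10 : ℚ)) : ℝ) (((29 / 5 : ℚ)) : ℝ) (-1) 0 0 0 0 (-1) 1 {1} (boxW 1)
      (termOp (boxD 1) TXb) := by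
  have hz : (0 : Site 2) ∈ boxW 1 := zero_mem_boxW 1
  have h1 : (1 : DihedralGroup 4) ∈ ({1} : Finset (DihedralGroup 4)) := Finset.mem_singleton_self 1
  have hmul : ∀ a ∈ ({1} : Finset (DihedralGroup 4)), ∀ b ∈ ({1} : Finset (DihedralGroup 4)),
      a * b ∈ ({1} : Finset (DihedralGroup 4)) := by
    intro a ha b hb
    rw [Finset.mem_singleton] at ha hb ⊢
    rw [ha, hb, mul_one]
  have hΛ : boxW 0 ⊆ boxW 1 := boxW_mono (by norm_num)
  have h8 : thicken (boxW 0) 1 ⊆ boxW 1 := thicken_boxW_subset 0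
  have h0 : thicken ({0} : Finset (Site 2)) 1 ⊆ boxW 1 := by rw [thicken_zero_one_eq]
  have hx4 : boxXs 1 (4 : Fin 9) = 0 := by decide
  have ho : ∀ σ : Fin 2, boxD 1 (orb (4 : Fin 9) σ) = orb (PolySite.pt 0 hz) σ := by
    intro σ
    rw [boxD_orb, pt_congr_b (boxXs_mem 1 (4 : Fin 9)) hz hx4]
  have hix0 : ∀ v ∈ thicken ({0} : Finset (Site 2)) 1, boxXs 1 (boxIx 1 v) = v := fun v hv =>
    boxXs_boxIx 1 v (by rwa [thicken_zero_one_eq] at hv)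
  have hokS : ∀ (γc : Fin 8) (v : ℤ × ℤ), Db.ok γc v = true → d4OfCode γc ∈ ({1} : Finset (DihedralGroup 4)) := by
    intro γc v h
    have h' : γc = 0 ∧ boxOk 1 γc v = true := by simpa [Db, Bool.and_eq_true, decide_eq_true_eq] using h
    rw [h'.1]
    exact h1
  have hokV : ∀ (γc : Fin 8) (v : ℤ × ℤ), Db.ok γc v = true → ∀ j : Fin 1,
      Db.xs (Db.ix (d4Vec (d4OfCode γc) (Db.xsβ j) + siteOfPair v)) = d4Vec (d4OfCode γc) (Db.xsβ j) + siteOfPair v := by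
    intro γc v h j
    have h' : γc = 0 ∧ boxOk 1 γc v = true := by simpa [Db, Bool.and_eq_true, decide_eq_true_eq] using h
    exact box_hokV (r := 0) (R := 1) (vmax := 1) (by norm_num) γc v h'.2 j
  have hH : termOp (boxD 1) THb = (hubbardTTPrimeFermionInteraction 1 (((-3 / 10 : ℚ)) : ℝ) (((29 / 5 : ℚ)) : ℝ)).localHamiltonian (boxW 1) := by
    rw [THb, termOp_hamTermsBox, Rat.cast_one]
  have hE : termOp (boxD 1) TEb = fermionEmbed (PolySite.incl h0)
      ((hubbardTTPrimeFermionInteraction 1 (((-3 / 10 : ℚ)) : ℝ) (((29 / 5 : ℚ)) : ℝ)).meanEnergyObs 1) := by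
    have h := termOp_energyTermsIdx (N := 9) 1 (-3 / 10) (29 / 5) (boxXs 1) (boxXs_mem 1) h0 (boxIx 1) hix0 (boxD 1) (boxD_orb 1)
    rw [Rat.cast_one] at h
    exact h
  have hchk := wordsb_checks
  simp only [Bool.and_eq_true] at hchk
  have hTG := termOp_flatten_gramContractSlices (d := boxD 1) 0 wordsb 1 (pairsOf wordsb Qb) (validP_pairsOf wordsb 1 Qb hchk.1.1)
    (sortedP_of_sortedB _ _ _ hchk.1.2) (countP_of_countB _ _ _ hchk.2)
  exact affineOrbitLowerRowN_of_quotAdjChainKernelCertGNear (-3 / 10) (29 / 5) (by norm_num) hΛ h8 h0 hz h1 hmul Db (boxXs_mem 1)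
    (boxXs_boxIx 1) (boxXs_mem 0) (boxQuot_hcovβ 0 1 1) (boxD 1) (boxD_injective 1) (boxD_orb 1) 32 (boxD 0) (boxQuot_hdΛ 0 1 1)
    (boxD_boxPush (r := 0) (R := 1) (by norm_num)) (fun p => (ofLex p).2) (boxD_spin 1) hokS hokV THb hH TEb hE (fun σ => orb 4 σ) ho TXb mub 0 0 0 0 0
    (gramContractSlices 0 wordsb (pairsOf wordsb Qb)) (gramTBCoef_posSemidef 0 (copyBlocks wordsb 1)) (gramTBOp (boxD 1) (copyBlocks wordsb 1))
    hTG [] [] (by decide) [] (fun wc hwc => absurd hwc List.not_mem_nil) [] [1, 1] 3 Cbs rfl hintsb box_chain_ok (by norm_num [mub])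
    box_lowerConst

end ToyBox1

end CARPolyWindow

end Summit.Ventures.CertifiedManyBodySolver
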